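import Mathlib.CategoryTheory.Sites.SheafCohomology.Basic
import Mathlib.CategoryTheory.Abelian.GrothendieckAxioms.Sheaf
import Mathlib.CategoryTheory.Abelian.GrothendieckCategory.HasExt
import Literature.Algebra.Homology.HyperExt
import Literature.AlgebraicGeometry.Motives.GrothendieckVanishingProofs
import Literature.AlgebraicGeometry.Motives.HodgeSheaves
import HarnessLib

/-!
# Hypercohomology `ℍⁿ(K)` of a complex of abelian sheaves

For a site `(C, J)` and a cochain complex `K` of abelian sheaves (`Sheaf J AddCommGrpCat`), the
**hypercohomology** `SheafHypercohomology J K n = Hom_{D(Sh)}(ℤ, K⟦n⟧)` (`n : ℤ`) is the hyper-Ext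
group `Literature.Algebra.Homology.HyperExt ℤ K n` from the constant sheaf `ℤ`
(`constantSheafInt J`), i.e. Mathlib's definition of sheaf cohomology `Sheaf.H F n = Extⁿ(ℤ, F)`
(`Mathlib.CategoryTheory.Sites.SheafCohomology.Basic`) extended from a sheaf to a complex; on a
single sheaf it *is* `Sheaf.H` (`sheafHypercohomology_single` is `rfl`, `hEquiv` the identity,
compatible with `Sheaf.H.map`: `hEquiv_map`). Classically (Weibel, Application 5.7.10 and 10.6.8)
`ℍⁿ(X, K)` is the hyper-derived functor `RⁿΓ(K) = Hⁿ(RΓ K)`; since `Γ = Hom(ℤ, -)` these agree with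
`Hom_D(ℤ, K⟦n⟧)` (Weibel Def. 10.7.1). For a topological space `X` take
`J = Opens.grothendieckTopology X` (the tree's `Motives.structureSheafCohomology`,
`Motives.hodgeCohomology` are literally instances: `structureSheafCohomology_eq`).

It is defined under the smallness hypothesis `HasHyperExt ℤ K`, which holds automatically for `K`
cohomologically bounded below (`Literature.Algebra.Homology.hasHyperExt_of_isGE`; instances for
`K.IsGE 0`, single sheaves, two-term complexes), given `HasExt (Sheaf J AddCommGrpCat)` (automatic
on small sites, where abelian sheaves form a Grothendieck abelian category).

## API (all inherited from `HyperExt`, restated here in sheaf language)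

* (a) `sheafHypercohomology_single`, `hEquiv`, `hEquiv_map`;
* (b) the long exact sequence of a short exact sequence of complexes of sheaves and its
  naturality: use `HyperExt.delta`, `HyperExt.exact₁/₂/₃(_apply)`, `HyperExt.sequence_exact`,
  `HyperExt.delta_naturality` directly (`SheafHypercohomology` is an `abbrev`);
* (c) two-term complexes `[F →φ G]` (`HyperExt.twoTermComplex φ`, `F` in degree `0`): the exact
  sequence `⋯ → ℍⁿ([F→G]) → Hⁿ(F) →φ Hⁿ(G) →∂ ℍⁿ⁺¹([F→G]) → Hⁿ⁺¹(F) → ⋯` with `Sheaf.H.map φ`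
  (`twoTerm_exact₁₂₃`); cohomological dimension `HasCohomologicalDimensionLE J d`
  (`hasCohomologicalDimensionLE_iff`: `Hⁿ(F) = 0` for all `F`, `n > d`), the vanishing
  `sheafHypercohomology_eq_zero` (`ℍⁿ(K) = 0` for `n > b + d` if `K` has cohomology in `[a, b]`;
  for `K` in degrees `[0, r-1]`: `n > d + r - 1`), `sheafHypercohomology_eq_zero_of_lt`, and the
  top-corner surjection `Hᵈ(G) ↠ ℍᵈ⁺¹([F → G])` (`twoTermδ_surjective`);
* `hasCohomologicalDimensionLE_of_noetherianSpace`: a noetherian space of Krull dimension `≤ d`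
  has cohomological dimension `≤ d` (Grothendieck vanishing, Hartshorne III.2.7, from the tree's
  `Motives.grothendieckVanishing_holds`).

Not here: (d) `lim`/`lim¹` along towers of complexes (Mittag-Leffler); the general stupid
filtration beyond two columns; the hypercohomology spectral sequences.

## References

* C. A. Weibel, *An introduction to homological algebra*, CUP 1994, Application 5.7.10, §10.6.8,
  Def. 10.7.1. [`Weibel1994`]
* R. Hartshorne, *Algebraic Geometry*, GTM 52, III Thm. 2.7. [`Hartshorne1977`]
-/

namespace Literature.AlgebraicGeometry.Crystalline

open CategoryTheory Limits Literature.Algebra.Homology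

universe w₁ w₀ v₀ u₀

section Site

variable {C : Type u₀} [Category.{v₀} C] (J : GrothendieckTopology C)
  [HasSheafify J AddCommGrpCat.{w₀}] [HasExt.{w₁} (Sheaf J AddCommGrpCat.{w₀})]

/-- The constant abelian sheaf `ℤ` (with values `ULift ℤ`) on the site `(C, J)`: the coefficient
object of Mathlib's sheaf cohomology `Sheaf.H F n = Extⁿ(ℤ, F)`. [folklore] -/
noncomputable abbrev constantSheafInt : Sheaf J AddCommGrpCat.{w₀} :=
  (constantSheaf J AddCommGrpCat.{w₀}).obj (AddCommGrpCat.of (ULift.{w₀} ℤ))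

/-- The **hypercohomology** `ℍⁿ(K) = Hom_{D(Sh(C,J))}(ℤ, K⟦n⟧)` (`n : ℤ`) of a cochain complex `K`
of abelian sheaves on a site: the hyper-Ext group (`Literature.Algebra.Homology.HyperExt`, Weibel
Def. 10.7.1) from the constant sheaf `ℤ`, exactly as Mathlib's `Sheaf.H F n = Extⁿ(ℤ, F)`, with
which it agrees on a single sheaf (`sheafHypercohomology_single`, `hEquiv`). Defined under the
smallness hypothesis `HasHyperExt ℤ K`, automatic for `K` cohomologically bounded below (e.g. in
degrees `≥ 0`); classically `ℍⁿ(X, K) = Rⁿ Γ(K) = Hⁿ(RΓ K)` (Weibel Application 5.7.10, 10.6.8, and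
`RΓ = RHom(ℤ, -)`). For a topological space `X` take `J = Opens.grothendieckTopology X`.
[cite: Weibel1994, Def. 10.7.1 and Application 5.7.10] -/
abbrev SheafHypercohomology (K : CochainComplex (Sheaf J AddCommGrpCat.{w₀}) ℤ)
    [HasHyperExt.{w₁} (constantSheafInt J) K] (n : ℤ) : Type w₁ :=
  HyperExt.{w₁} (constantSheafInt J) K n

variable {J}

/-- On a single sheaf `F[0]`, hypercohomology in degree `n : ℕ` is, by definition, Mathlib's sheaf
cohomology `Sheaf.H F n`. [folklore] -/
theorem sheafHypercohomology_single (F : Sheaf J AddCommGrpCat.{w₀}) (n : ℕ) :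
    SheafHypercohomology J ((CochainComplex.singleFunctor _ 0).obj F) n = Sheaf.H.{w₁} F n :=
  rfl

/-- The identification `Hⁿ(F) ≃+ ℍⁿ(F[0])` (the identity). [folklore] -/
noncomputable def hEquiv (F : Sheaf J AddCommGrpCat.{w₀}) (n : ℕ) :
    Sheaf.H.{w₁} F n ≃+ SheafHypercohomology J ((CochainComplex.singleFunctor _ 0).obj F) n :=
  HyperExt.extEquiv _ F n

/-- `hEquiv` transforms `Sheaf.H.map f` into `HyperExt.map f[0]`. [folklore] -/
theorem hEquiv_map {F G : Sheaf J AddCommGrpCat.{w₀}} (f : F ⟶ G) (n : ℕ) (x : Sheaf.H.{w₁} F n) :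
    hEquiv G n (Sheaf.H.map f n x) =
      HyperExt.map ((CochainComplex.singleFunctor _ 0).map f) n (hEquiv F n x) :=
  HyperExt.extEquiv_comp_mk₀ x f

/-! ### Cohomological dimension -/

variable (J) in
/-- The site `(C, J)` has **cohomological dimension `≤ d`**: `Hⁿ(F) = 0` for every abelian sheaf
`F` and every `n > d`; phrased as `HasProjectiveDimensionLE ℤ d` for the constant sheaf
(`hasCohomologicalDimensionLE_iff`). [folklore] -/
abbrev HasCohomologicalDimensionLE (d : ℕ) : Prop :=
  HasProjectiveDimensionLE (constantSheafInt.{w₀} J) d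

/-- Cohomological dimension `≤ d` means `Hⁿ(F) = 0` for all `F` and `n > d`. [folklore] -/
theorem hasCohomologicalDimensionLE_iff (d : ℕ) :
    HasCohomologicalDimensionLE J d ↔
      ∀ (F : Sheaf J AddCommGrpCat.{w₀}) (n : ℕ), d < n → ∀ x : Sheaf.H.{w₁} F n, x = 0 := by
  rw [HasCohomologicalDimensionLE, HasProjectiveDimensionLE, hasProjectiveDimensionLT_iff.{w₁}]
  exact ⟨fun h F n hn x => h n hn x, fun h n hn F x => h F n hn x⟩

/-- **Vanishing**: on a site of cohomological dimension `≤ d`, a complex `K` of abelian sheaves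
with cohomology sheaves in degrees `[a, b]` has `ℍⁿ(K) = 0` for `n > b + d`; for `K` in degrees
`[0, r - 1]`: `ℍⁿ(K) = 0` for `n > d + r - 1`. [folklore] -/
theorem sheafHypercohomology_eq_zero (d : ℕ) [HasCohomologicalDimensionLE J d]
    (K : CochainComplex (Sheaf J AddCommGrpCat.{w₀}) ℤ) [HasHyperExt.{w₁} (constantSheafInt J) K]
    (a b : ℤ) [K.IsGE a] [K.IsLE b] {n : ℤ} (hn : b + d < n) (x : SheafHypercohomology J K n) :
    x = 0 :=
  HyperExt.eq_zero_of_hasProjectiveDimensionLE d a b hn x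

omit [HasExt.{w₁} (Sheaf J AddCommGrpCat.{w₀})] in
/-- `ℍⁿ(K) = 0` for `n < a` if `K` has cohomology sheaves in degrees `≥ a` only. [folklore] -/
theorem sheafHypercohomology_eq_zero_of_lt (K : CochainComplex (Sheaf J AddCommGrpCat.{w₀}) ℤ)
    [HasHyperExt.{w₁} (constantSheafInt J) K] (a : ℤ) [K.IsGE a] {n : ℤ} (hn : n < a)
    (x : SheafHypercohomology J K n) : x = 0 :=
  HyperExt.eq_zero_of_isGE a hn x

/-! ### Two-term complexes of sheaves -/

section TwoTerm

variable {F G : Sheaf J AddCommGrpCat.{w₀}} (φ : F ⟶ G)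

/-- Exactness of `ℍⁿ([F → G]) → Hⁿ(F) →φ Hⁿ(G)` (`HyperExt.twoTermFst`, `Sheaf.H.map`).
[folklore] -/
theorem twoTerm_exact₂ (n : ℕ) :
    Function.Exact (HyperExt.twoTermFst (constantSheafInt J) φ n) (Sheaf.H.map φ n) :=
  HyperExt.twoTerm_exact₂ _ φ n

/-- Exactness of `Hⁿ⁰(F) →φ Hⁿ⁰(G) →∂ ℍⁿ¹([F → G])` (`n₀ + 1 = n₁`). [folklore] -/
theorem twoTerm_exact₃ (n₀ n₁ : ℕ) (h : n₀ + 1 = n₁) :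
    Function.Exact (Sheaf.H.map φ n₀) (HyperExt.twoTermδ (constantSheafInt J) φ n₀ n₁ h) :=
  HyperExt.twoTerm_exact₃ _ φ n₀ n₁ h

/-- Exactness of `Hⁿ⁰(G) →∂ ℍⁿ¹([F → G]) → Hⁿ¹(F)` (`n₀ + 1 = n₁`). [folklore] -/
theorem twoTerm_exact₁ (n₀ n₁ : ℕ) (h : n₀ + 1 = n₁) :
    Function.Exact (HyperExt.twoTermδ (constantSheafInt J) φ n₀ n₁ h)
      (HyperExt.twoTermFst (constantSheafInt J) φ n₁) :=
  HyperExt.twoTerm_exact₁ _ φ n₀ n₁ h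

/-- **Top-corner surjection**: on a site of cohomological dimension `≤ d`,
`Hᵈ(G) →∂ ℍᵈ⁺¹([F → G])` is surjective. [folklore] -/
theorem twoTermδ_surjective (d : ℕ) [HasCohomologicalDimensionLE J d] :
    Function.Surjective (HyperExt.twoTermδ (constantSheafInt J) φ d (d + 1) rfl) :=
  HyperExt.twoTermδ_surjective _ d φ

end TwoTerm

end Site

/-! ### Topological spaces -/

section TopCat

open TopologicalSpace

variable (X : TopCat.{u₀})

/-- On a noetherian topological space of Krull dimension `≤ d`, the site of opens has
cohomological dimension `≤ d` (Grothendieck's vanishing theorem, Hartshorne III.2.7, proved in the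
tree as `Motives.grothendieckVanishing_holds`). [cite: Hartshorne1977, III Thm. 2.7] -/
theorem hasCohomologicalDimensionLE_of_noetherianSpace [NoetherianSpace X] (d : ℕ)
    (hd : topologicalKrullDim X ≤ d) :
    HasCohomologicalDimensionLE.{u₀} (Opens.grothendieckTopology X) d := by
  rw [hasCohomologicalDimensionLE_iff]
  intro F n hn x
  have : Subsingleton (Sheaf.H.{u₀} F n) :=
    Literature.AlgebraicGeometry.Motives.grothendieckVanishing_holds X F n
      (lt_of_le_of_lt hd (by exact_mod_cast hn))
  exact Subsingleton.elim _ _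

/-- The tree's `structureSheafCohomology X q = H^q(X, 𝒪_X)` (`Motives/Differentials`) is the
hypercohomology of the single complex `𝒪_X[0]` (definitionally). [folklore] -/
theorem structureSheafCohomology_eq (Y : AlgebraicGeometry.Scheme.{u₀}) (q : ℕ) :
    Literature.AlgebraicGeometry.Motives.structureSheafCohomology Y q =
      SheafHypercohomology (Opens.grothendieckTopology Y.carrier)
        ((CochainComplex.singleFunctor _ 0).obj
          ((SheafOfModules.toSheaf Y.ringCatSheaf).obj (SheafOfModules.unit Y.ringCatSheaf))) q :=
  rfl

/-- The tree's Hodge cohomology `hodgeCohomology X a b = Hᵇ(X, Ωᵃ_{X/k})` (`Motives/HodgeSheaves`)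
is the hypercohomology of the single complex `Ωᵃ[0]` (definitionally). [folklore] -/
theorem hodgeCohomology_eq {k : Type u₀} [CommRing k]
    (Y : Over (AlgebraicGeometry.Spec (CommRingCat.of k))) (a b : ℕ) :
    Literature.AlgebraicGeometry.Motives.hodgeCohomology Y a b =
      SheafHypercohomology (Opens.grothendieckTopology Y.left.carrier)
        ((CochainComplex.singleFunctor _ 0).obj ((SheafOfModules.toSheaf Y.left.ringCatSheaf).obj
          (Literature.AlgebraicGeometry.Motives.hodgeSheaf Y a))) b :=
  rfl

end TopCat

end Literature.AlgebraicGeometry.Crystalline
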